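import Summits.QuantumFields.YangMills.Theorems.ParabolicTrajectoryContinuumLimitOnTrajectoryStubOSLegsD_Assembly
import Summits.QuantumFields.YangMills.Theorems.ParabolicTrajectoryContinuumLimitOnTrajectoryStubArp
import Summits.QuantumFields.YangMills.Theorems.ParabolicTrajectoryContinuumLimitOnTrajectoryStubTransl
import Summits.QuantumFields.YangMills.Theorems.ParabolicTrajectoryContinuumLimitOnTrajectoryUvbOfUuvb
import Summits.QuantumFields.YangMills.Theorems.ParabolicTrajectoryContinuumLimitOnTrajectoryDefsE
import Summits.QuantumFields.YangMills.Theorems.ParabolicTrajectoryContinuumLimitOnTrajectoryStubAxisSymmetry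
import Summits.QuantumFields.YangMills.Theorems.ParabolicTrajectoryContinuumLimitOnTrajectoryUclTop
import Summits.QuantumFields.YangMills.Theorems.ConvexGribovBodyContinuumLegGivenGapStubRotOfPythagorean
import Summits.QuantumFields.YangMills.Theorems.ConvexGribovBodyContinuumLegGivenGapStubRotNiven
import Summits.QuantumFields.YangMills.Theorems.ConvexGribovBodyContinuumLegGivenGapStubRotHyper
import Summits.QuantumFields.YangMills.Theorems.OneCertifiedCubeContinuumLimitExistsStubOddTorusRP
import Summits.QuantumFields.YangMills.Theorems.OneCertifiedCubeContinuumLimitExistsUvSchemeOfUvBounds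
import Summits.QuantumFields.YangMills.Theses.OneCertifiedCube

/-!
# Route `OneCertifiedCube`, crux `ContinuumLimitExists` (stmt-QuantumFields-16124): the crux from the three registered stub STATEMENTS of line `birth` v5

The composition `ContinuumLimitExists_of` of the registered skeleton `Cruxes/ContinuumLimitExists/Lines/birth.lean` (v5,
continuation lead `prover-line-stmt-QuantumFields-16124-c2-0`, 2026-08-17) as a TREE theorem with the three open stub
statements as explicit hypotheses (verbatim the registered signatures of `stub_uvBounds`, `stub_rotation345`,
`stub_coreClustering`; the fourth leg `stub_oddTorusRP` is landed, p146480, and is used by name):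

* `continuumLimitExists_of_birthStubs : (∃-leg: weak ∧ PVG ∧ UUVB ∧ ND2 ∧ ND3) → (E1 leg: ⊢ Rot345) → (E4 leg: ⊢ CoreClustering)
  → ContinuumLimitExists`.

So the crux E is kernel-certified CLOSED MODULO exactly these three named statements — UV stability with observables and
non-degeneracy along SOME weak-coupling Wilson sequence (no convergence: `uvScheme_of_uvBounds`, p160142), O(4) restoration on
one Pythagorean rotation, and rate-free time clustering, the latter two along EVERY weak-coupling, polynomially growing,
product-convergent, UUVB sequence — by the landed one-field Osterwalder–Schrader packaging of route ParabolicTrajectory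
(`oneFieldOSLegs'`, `stub_arp`, `stub_transl`, `uvb_of_uuvb`, `asympEuclid_iff`) and the landed upgrades of crux
stmt-QuantumFields-15828 (`stub_rotOfPythagorean`, `ucl_of_core` with `stub_axisSymmetry`). A planner promoting the stubs to
items cites this theorem as the glue (`--glue-by`). Refs: `Cruxes/ContinuumLimitExists/{Lines/birth.lean, LEAD-SUMMARY.md}`.
-/

set_option autoImplicit false

noncomputable section

namespace Summit.QuantumFields.YangMills.Cruxes.ContinuumLimitExists.Birth

open Filter Topology
open Literature.MathematicalPhysics.QuantumFieldTheory
open Summit.QuantumFields.YangMills.Cruxes.ContinuumLimitOnTrajectory.TwoOrbitSynchronisation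

/-- **The crux from the three registered stub statements of line `birth` v5** (registered glue anchor). Take `(r, sch)`
with full-sequence product convergence from the ∃-leg by the compactness glue `uvScheme_of_uvBounds`; `UVB` by
`uvb_of_uuvb`; translations by `stub_transl`, rotations from the E1 leg by `stub_rotOfPythagorean` (Niven + hyperoctahedral
generation), so `AsympEuclid`; `0 ≤ β_k` eventually from `β_k → ∞`, hence odd-torus reflection positivity (`stub_oddTorusRP`,
landed) and `ARP` (`stub_arp`); `UCL` from the E4 leg by `ucl_of_core` with exact axis symmetry; then `oneFieldOSLegs'` packages
OS data over all species, Yang–Mills along `canon r sch`, non-trivial and non-Gaussian on the curvature; `canon` keeps `β`. -/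
theorem continuumLimitExists_of_birthStubs :
    (∀ (G : Type) [Group G] [TopologicalSpace G] [IsTopologicalGroup G] [CompactSpace G]
      [MeasurableSpace G] [BorelSpace G], IsCompactSimpleLieGroup G →
      ∃ (r : LatticeRep G) (sch : SpeciesScheme (YMSpecies G)),
        sch.HasWeakCouplingLimit ∧ PolyVolumeGrowth sch ∧ UUVB r sch ∧ ND2 r sch ∧ ND3 r sch) →
    (∀ (G : Type) [Group G] [TopologicalSpace G] [IsTopologicalGroup G] [CompactSpace G]
      [MeasurableSpace G] [BorelSpace G], IsCompactSimpleLieGroup G →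
      ∀ (r : LatticeRep G) (sch : SpeciesScheme (YMSpecies G)),
        sch.HasWeakCouplingLimit → PolyVolumeGrowth sch → ConvProducts r sch → UUVB r sch →
          Rot345 r sch) →
    (∀ (G : Type) [Group G] [TopologicalSpace G] [IsTopologicalGroup G] [CompactSpace G]
      [MeasurableSpace G] [BorelSpace G], IsCompactSimpleLieGroup G →
      ∀ (r : LatticeRep G) (sch : SpeciesScheme (YMSpecies G)),
        sch.HasWeakCouplingLimit → PolyVolumeGrowth sch → ConvProducts r sch → UUVB r sch →
          CoreClustering r sch) →
    Summit.QuantumFields.YangMills.Theses.OneCertifiedCube.ContinuumLimitExists := by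
  intro h₁ h₂ h₄ G _ _ _ _ hG
  letI : MeasurableSpace G := borel G
  haveI : BorelSpace G := ⟨rfl⟩
  obtain ⟨r, sch, hW, hGr, hconv, hU, hND2, hND3⟩ := uvScheme_of_uvBounds h₁ G hG
  have hUVB : UVB r sch := uvb_of_uuvb r sch hU
  have hRot : AsympRot r sch :=
    Summit.QuantumFields.YangMills.Theorems.ContinuumLegGivenGap.stub_rotOfPythagorean G r sch
      Summit.QuantumFields.YangMills.Theorems.ContinuumLegGivenGap.stub_rotNiven
      Summit.QuantumFields.YangMills.Theorems.ContinuumLegGivenGap.stub_rotHyper hU (h₂ G hG r sch hW hGr hconv hU)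
  have hE1 : AsympEuclid r sch := (asympEuclid_iff r sch).2 ⟨stub_transl G r sch hGr hU, hRot⟩
  have hARP : ARP r sch := stub_arp G r sch (stub_oddTorusRP G r sch (hW.eventually_ge_atTop 0)) hU hUVB
  have hUCL : UCL r sch := ucl_of_core r sch (stub_axisSymmetry G r sch) hGr hU (h₄ G hG r sch hW hGr hconv hU)
  obtain ⟨T, hYM, hNT, hNG⟩ := oneFieldOSLegs' G r sch hconv hUVB hE1 hARP hUCL hND2 hND3
  exact ⟨r, canon r sch, T, hW, hYM, hNT, hNG⟩

end Summit.QuantumFields.YangMills.Cruxes.ContinuumLimitExists.Birth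

end
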